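import Literature.AlgebraicGeometry.Motives.CurveGeneralDivisorsAtPoints
import Literature.AlgebraicGeometry.Motives.SymmetricPowerProjective
import HarnessLib

/-!
# The chart `W ⊆ C^{(g)}`: the image of the general locus in the symmetric power
# (Milne, *Jacobian Varieties*, §4 Prop. 4.2 (a), §5 Thm. 5.1)

For a smooth projective geometrically integral curve `C / K` the general locus
`{t : h⁰(Σ tᵢ) = 1} ⊆ Cᵍ` (`generalLocus`, `Motives/CurveGeneralDivisorsOpen`) is stable under the
symmetric group (`permOver_mem_generalLocus_iff`: the coordinate divisor of `σ · t` is a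
permutation of that of `t`, read at the field-valued point `Spec κ(t) → Cᵍ → Cᵍ`,
`imagePtPow_mem_generalLocus_iff`), hence saturated for the quotient map
`Cᵍ → C^{(g)} = symPowProj C hC g` (`preimage_image_generalLocus`, fibres = orbits,
`symPowProj.mk_eq_iff`). Its image **`chartW C g hC ⊆ C^{(g)}`** is therefore OPEN
(`isOpen_chartW`: the quotient map is integral, hence closed, and the complement of `W` is the
image of the closed complement of the general locus; under the semicontinuity hypothesis
`CechPseudoCoherentAt C` of `isOpen_generalLocus`), with preimage the general locus
(`preimage_chartW`) and non-empty when the general locus is (`chartW_nonempty`, cf.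
`exists_galois_nonempty_generalLocus`); `chartWOpens` is `W` as an open subscheme. This is the
open `U' ⊆ C^{(g)}` of Milne §5 (image of the `U` of Lemma 5.2 (b)) on which `f^{(g)}` is
injective / an open immersion (Thm. 5.1), i.e. the chart of the Jacobian.

Everything is proved; no named facts (D-0026). Part of the construction of the Jacobian
(`nonempty_jacobian_of_isSmoothProjective`).

## References

* J. S. Milne, *Jacobian Varieties*, in: Arithmetic Geometry (Cornell–Silverman, eds.), Springer
  1986, §4 Prop. 4.2 (a), §5 Lemma 5.2, Thm. 5.1 (pp. 248–252 of the volume).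
  [Milne1986JacobianVarieties]
* D. Mumford, *Abelian Varieties* (1970), §7 Thm. p. 66 (quotients by finite groups).
  [MumfordAV1970]
-/

noncomputable section

open CategoryTheory CategoryTheory.Limits AlgebraicGeometry IsLocalRing Order TopologicalSpace
  MonoidalCategory CartesianMonoidalCategory

universe u

namespace Literature.AlgebraicGeometry.Motives

open Literature.AlgebraicGeometry.RelativeSpec

namespace CurvePlaces

open RatFn FieldPoint CartierDivisor Literature.NumberTheory.DiophantineGeometry
  Literature.NumberTheory.DiophantineGeometry.AlgFunctionField

variable {K : Type u} [Field K] (C : SchemeOver K) [IsIntegral C.left]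
  [SmoothOfRelativeDimension 1 C.hom] [IsProper C.hom] [GeometricallyIntegral C.hom] (g : ℕ)

/-! ### The general locus is symmetric -/

omit [IsIntegral C.left] in
/-- The coordinate divisor of `σ · τ` is that of `τ` (a permutation of the summands). [folklore] -/
theorem coordDivisorAt_permOver {L : Type u} [Field L] (π : Spec (.of L) ⟶ Spec (.of K))
    (τ : Over.mk π ⟶ powC C g) (σ : Equiv.Perm (Fin g)) :
    coordDivisorAt C g π (τ ≫ permOver C.hom g σ) = coordDivisorAt C g π τ := by
  unfold coordDivisorAt
  have hc : ∀ i, (τ ≫ permOver C.hom g σ) ≫ coord C g i = τ ≫ coord C g (σ.symm i) := fun i ↦ by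
    rw [Category.assoc]
    exact congrArg (τ ≫ ·) (permOver_projOver C.hom g σ i)
  simp only [hc]
  exact Equiv.sum_comp σ.symm (fun i ↦ Finsupp.single (place (curveBC C π)
    (ratPtPoint C π (τ ≫ coord C g i)) (ratPtPoint_ne_genericPoint C _ _)) (1 : ℤ))

/-- **The general locus is stable under the symmetric group.** [folklore] -/
theorem permOver_mem_generalLocus_iff (σ : Equiv.Perm (Fin g)) (t : (powC C g).left) :
    (permOver C.hom g σ).left t ∈ generalLocus C g ↔ t ∈ generalLocus C g := by
  have h1 := imagePtPow_mem_generalLocus_iff C g (residuePt (powC C g) t).hom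
    (residuePtι (powC C g) t ≫ permOver C.hom g σ)
  have h0 := imagePtPow_mem_generalLocus_iff C g (residuePt (powC C g) t).hom
    (residuePtι (powC C g) t)
  have e1 : imagePtPow C g (residuePt (powC C g) t).hom
      (residuePtι (powC C g) t ≫ permOver C.hom g σ) = (permOver C.hom g σ).left t := by
    change ((residuePtι (powC C g) t ≫ permOver C.hom g σ).left) (closedPoint _) = _
    rw [Over.comp_left, Scheme.Hom.comp_apply, residuePtι_left_apply]
  have e0 : imagePtPow C g (residuePt (powC C g) t).hom (residuePtι (powC C g) t) = t :=
    residuePtι_left_apply (powC C g) t _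
  rw [e1, coordDivisorAt_permOver] at h1
  rw [e0] at h0
  rw [h1, h0]

/-- The general locus is saturated for the quotient map `Cᵍ → C^{(g)}`. [folklore] -/
theorem preimage_image_generalLocus (hC : IsProjectiveOver C) :
    (symPowProj.mk C hC g).left ⁻¹' ((symPowProj.mk C hC g).left '' generalLocus C g) =
      generalLocus C g := by
  ext t
  constructor
  · rintro ⟨t', ht', he⟩
    obtain ⟨σ, rfl⟩ := (symPowProj.mk_eq_iff C hC g t' t).1 he
    exact (permOver_mem_generalLocus_iff C g σ t').2 ht'
  · exact fun ht ↦ ⟨t, ht, rfl⟩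

/-! ### The chart `W` -/

/-- **The chart `W ⊆ C^{(g)}`**: the image of the general locus `{h⁰(Σ tᵢ) = 1} ⊆ Cᵍ` in the
symmetric power (Milne §4–§5: the open of `C^{(g)}` where `f^{(g)} : C^{(g)} → J` will be an open
immersion, Thm. 5.1). [cite: Milne1986JacobianVarieties, §4 Prop. 4.2 (a) and §5 Thm. 5.1] -/
def chartW (hC : IsProjectiveOver C) : Set (symPowProj C hC g).left :=
  (symPowProj.mk C hC g).left '' generalLocus C g

/-- The complement of `W` is the image of the complement of the general locus. [folklore] -/
theorem compl_chartW (hC : IsProjectiveOver C) :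
    (chartW C g hC)ᶜ = (symPowProj.mk C hC g).left '' (generalLocus C g)ᶜ := by
  ext y
  obtain ⟨t, rfl⟩ := symPowProj.mk_surjective C hC g y
  constructor
  · intro hy
    refine ⟨t, fun ht ↦ hy ⟨t, ht, rfl⟩, rfl⟩
  · rintro ⟨t', ht', he⟩ ⟨t'', ht'', he'⟩
    apply ht'
    have h1 : t' ∈ (symPowProj.mk C hC g).left ⁻¹' ((symPowProj.mk C hC g).left '' generalLocus C g) :=
      ⟨t'', ht'', he'.trans he.symm⟩
    rwa [preimage_image_generalLocus] at h1

/-- **`W` is open** (the quotient map is closed — it is integral — and the general locus is a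
saturated open, `isOpen_generalLocus`). [cite: Milne1986JacobianVarieties, §4 Prop. 4.2 (a)] -/
theorem isOpen_chartW (hC : IsProjectiveOver C) (hX : CechPseudoCoherentAt C) :
    IsOpen (chartW C g hC) := by
  haveI := hC.isSeparated
  haveI : IsSeparated C.hom := hC.isSeparated
  haveI : IsIntegralHom (symPowProj.mk C hC g).left := by
    change IsIntegralHom (symPowGlued.mk C.hom g hC.finiteSubsetsInAffineOpens)
    unfold symPowGlued.mk
    exact ActionOver.isIntegralHom_gluedMk _ _
  haveI : UniversallyClosed (symPowProj.mk C hC g).left := inferInstance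
  rw [← isClosed_compl_iff, compl_chartW]
  exact (symPowProj.mk C hC g).left.isClosedMap _ (isOpen_generalLocus C g hX).isClosed_compl

/-- The preimage of `W` is the general locus. [folklore] -/
theorem preimage_chartW (hC : IsProjectiveOver C) :
    (symPowProj.mk C hC g).left ⁻¹' chartW C g hC = generalLocus C g :=
  preimage_image_generalLocus C g hC

omit [IsIntegral C.left] in
/-- `W` is non-empty as soon as the general locus is. [folklore] -/
theorem chartW_nonempty (hC : IsProjectiveOver C) (h : (generalLocus C g).Nonempty) :
    (chartW C g hC).Nonempty :=
  h.image _

/-- **The chart `W` as an open subscheme of `C^{(g)}`.** [cite: Milne1986JacobianVarieties, §5 Thm. 5.1] -/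
def chartWOpens (hC : IsProjectiveOver C) (hX : CechPseudoCoherentAt C) : (symPowProj C hC g).left.Opens :=
  ⟨chartW C g hC, isOpen_chartW C g hC hX⟩

end CurvePlaces

end Literature.AlgebraicGeometry.Motives
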